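import Literature.AlgebraicGeometry.ModuliOfAbelianVarieties.SiegelTripleDualLevelStructure
import Literature.AlgebraicGeometry.AbelianSchemes.PolarizationLamEtale
import HarnessLib

/-!
# The polarisation `λ′ : A′ → Â′` of every triple classified by a Siegel fine moduli scheme is surjective, flat, ÉTALE and
# FINITE — over ANY locally noetherian `ℚ`-scheme

Layer `Literature/AlgebraicGeometry/ModuliOfAbelianVarieties`, namespace
`Literature.AlgebraicGeometry.ModuliOfAbelianVarieties.SiegelFineModuliScheme`.  THEOREMS ONLY (no definition, no named fact,
no instance, no `sorry`).

[MumfordFogartyKirwan1994] Ch. 6 §2 Lemma 6.12 (p. 122) / Prop. 6.13 (iii) (p. 123): the polarisation `Λ(L) : X → X̂` of a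
polarised abelian scheme is a finite flat surjective homomorphism; over a `ℚ`-scheme it is moreover ÉTALE (Cartier,
[GortzWedhorn2023] Thm. 27.25 / Cor. 27.63; [MumfordAV1970] §7 Thm. 4).  This file is the three-line junction of ★
`AbelianSchemes/PolarizationLamEtale` (B-p11 (g14): `Polarization.surjective/flat/etale/isFinite_lam_left(_of_charZero)` under
the ONE input «every geometric fibre `λ̄_t` is an isogeny») with ★ `SiegelTripleDualLevelStructure ::
isIsogeny_fibreHom_lam_of_classify` (B-p02 (g11): that input holds for every triple `P′` classified by a fine moduli scheme
`𝓜 = 𝒜_{g,δ,N} ⊗ ℚ` with `𝓜.M → Spec ℚ` locally of finite type, over any locally noetherian `ℚ`-scheme `T`, by pull-back from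
the universal triple, [MumfordFogartyKirwan1994] Ch. 7 §3 Thm. 7.9):

* **`surjective_lam_left_of_classify`**, **`flat_lam_left_of_classify`**, **`etale_lam_left_of_classify`**,
  **`isFinite_lam_left_of_classify`** — `λ′ : A′ → Â′` is surjective, flat, étale and finite;
* (the consumer's third binder `[QuasiCompact pol.lam.left]` is hypothesis-free: ★ `Polarization.quasiCompact_lam_left`).

Cell `hodgecm-mathlib` (D-0151), HECKE-LINK socket (B), (cov-3B) adapter for the (B5) assembly (the `[Flat] [Surjective]
[QuasiCompact] pol.lam.left` binders of ★ `Polarization.exists_quasiInverse` for triples over a thick piece `S″`); count-neutral.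
HC_CM is proved only modulo the 7 printed citations until rung 0 closes.

## References
* [MumfordFogartyKirwan1994] D. Mumford, J. Fogarty, F. Kirwan, *GIT* 3rd ed. (1994), Ch. 6 §2 Lemma 6.12 (p. 122), Prop. 6.13
  (iii) (p. 123); Ch. 7 §3 Thm. 7.9 (p. 139).
* [MumfordAV1970] D. Mumford, *Abelian Varieties* (1970), §7 Thm. 4 (p. 72), §8 Thm. 1 (p. 77).
* [GortzWedhorn2023] U. Görtz, T. Wedhorn, *Algebraic Geometry II* (2023), Thm. 27.25 and Cor. 27.63.
-/

set_option autoImplicit false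

noncomputable section

open CategoryTheory CategoryTheory.Limits AlgebraicGeometry

namespace Literature.AlgebraicGeometry.ModuliOfAbelianVarieties

namespace SiegelFineModuliScheme

open Literature.AlgebraicGeometry.AbelianSchemes Literature.AlgebraicGeometry.AbelianSchemes.AbelianSchemeOver
  Literature.AlgebraicGeometry.Motives

variable {g N : ℕ} {δ : Fin g → ℕ} (𝓜 : SiegelFineModuliScheme g N δ) [LocallyOfFiniteType 𝓜.M.hom]
  {T : SchemeOver ℚ} [IsLocallyNoetherian T.left] (P' : PolarizedAbelianSchemeWithLevel g N δ T.left)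

include 𝓜

/-- **`λ′ : A′ → Â′` is SURJECTIVE** for every triple classified by `𝓜` over a locally noetherian `ℚ`-scheme (★
`Polarization.surjective_lam_left` ∘ ★ `isIsogeny_fibreHom_lam_of_classify`). [cite: MumfordAV1970, §8 Thm. 1 (p. 77)]
[cite: MumfordFogartyKirwan1994, Ch. 7 §3 Theorem 7.9 (p. 139)] -/
theorem surjective_lam_left_of_classify : Surjective P'.pol.lam.left := by
  haveI := P'.pol.isMonHom
  exact P'.pol.surjective_lam_left (𝓜.isIsogeny_fibreHom_lam_of_classify P')

/-- **`λ′ : A′ → Â′` is FLAT** for every triple classified by `𝓜` ([MumfordFogartyKirwan1994] Lemma 6.12; ★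
`Polarization.flat_lam_left` ∘ ★ `isIsogeny_fibreHom_lam_of_classify`). [cite: MumfordFogartyKirwan1994, Ch. 6 §2 Lemma 6.12 (p. 122)]
[cite: MumfordFogartyKirwan1994, Ch. 7 §3 Theorem 7.9 (p. 139)] -/
theorem flat_lam_left_of_classify : Flat P'.pol.lam.left := by
  haveI := P'.pol.isMonHom
  exact P'.pol.flat_lam_left (𝓜.isIsogeny_fibreHom_lam_of_classify P')

/-- **`λ′ : A′ → Â′` is ÉTALE** for every triple classified by `𝓜` over a locally noetherian `ℚ`-scheme `T` (characteristic
`0` via `T.hom : T → Spec ℚ`; Cartier, ★ `Polarization.etale_lam_left_of_charZero` ∘ ★ `isIsogeny_fibreHom_lam_of_classify`).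
[cite: GortzWedhorn2023, Thm. 27.25 and Cor. 27.63] [cite: MumfordAV1970, §7 Thm. 4 (p. 72)]
[cite: MumfordFogartyKirwan1994, Ch. 7 §3 Theorem 7.9 (p. 139)] -/
theorem etale_lam_left_of_classify : Etale P'.pol.lam.left := by
  haveI := P'.pol.isMonHom
  exact P'.pol.etale_lam_left_of_charZero T.hom (𝓜.isIsogeny_fibreHom_lam_of_classify P')

/-- **`λ′ : A′ → Â′` is FINITE** for every triple classified by `𝓜` ([MumfordFogartyKirwan1994] Prop. 6.13 (iii) «the finite flat
morphism `Λ(L)`»; ★ `Polarization.isFinite_lam_left_of_charZero` ∘ ★ `isIsogeny_fibreHom_lam_of_classify`).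
[cite: MumfordFogartyKirwan1994, Ch. 6 §2 Proposition 6.13 (iii) (p. 123)] [cite: MumfordFogartyKirwan1994, Ch. 7 §3 Theorem 7.9 (p. 139)] -/
theorem isFinite_lam_left_of_classify : IsFinite P'.pol.lam.left := by
  haveI := P'.pol.isMonHom
  exact P'.pol.isFinite_lam_left_of_charZero T.hom (𝓜.isIsogeny_fibreHom_lam_of_classify P')

end SiegelFineModuliScheme

end Literature.AlgebraicGeometry.ModuliOfAbelianVarieties

end
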